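import Summits.AnomalousDissipation.AnomalousDissipation.Theorems.SawtoothPulseCascadeK1LocalisedCascadeAxisBlock
import Literature.Analysis.FunctionSpaces.TorusTimePeriodicLift

/-!
# K1loc, line `Spectral` — S-D (first good piece, thin start): THE STRIP BLOCKS OF THE SPECTRUM ARE ENERGIES OF TWISTED AXIS AVERAGES

Helper file of the prover lane on the crux `K1LocalisedCascade` (stmt-AnomalousDissipation-19491), route
`SawtoothPulseCascade` (glue seat k1loc-p3; S-B ↔ S-D hand-over).  With the thin-start closer
(`…K1Ledger.From.k1Localised_of_thin_iterate_bound`) the tracked set of the ledger at the hand-over phase contains the whole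
horizontal STRIP `{k : |kᵢ| ≤ 1.004·c(γ²−3)^n}` (all transversal frequencies), not only the column `{kᵢ = 0}` of
`…AxisBlock`; its energy must be bounded uniformly in the number of columns.  This file is the Fourier bookkeeping that
reduces such strip energies to LINE quantities (the strip twin of `…AxisBlock`):

* §1 the TWISTED axis average `x ↦ ∫ e_{−m}(s) v(x + s eᵢ) ds` (the `m`-th Fourier coefficient of `v` along the line through
  `x` in direction `eᵢ`): it is continuous for continuous `v` and `𝓕(twisted avg)(k) = [kᵢ = m]·𝓕v(k)`
  (`mFourierCoeff_twistedAxisAvg`; `m = 0` is `…AxisBlock.mFourierCoeff_axisAvg`);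
* §2 `hasSum_slab` — Parseval on the slab `{kᵢ = m}`: `Σ_{kᵢ = m}‖𝓕v(k)‖² = ∫ ‖∫ e_{−m}(s)v(x + s eᵢ)ds‖² dx`;
* §3 `tsum_strip_eq` — for a finitely supported transversal weight `φ` (e.g. the square of the ledger's radial symbol
  `(1 − sT((|m|−L)/(εL)))²`, supported in `|m| ≤ L(1+ε)`): `Σ' k, φ(kᵢ)‖𝓕v(k)‖² = Σ_m φ(m)·∫ ‖∫ e_{−m}(s)v(x + s eᵢ)ds‖² dx`;
* §4 the real-scalar / interval-integral form (`tsum_strip_real_eq`, `tsum_strip_real_le`): the line quantity is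
  `∫₀¹ e_{−m}(σ)·θ(x + σeᵢ) dσ`, i.e. exactly the modulated chord integrals bounded line by line by the S-D lane
  (`…ChordSum.norm_chord_integral_le`, `…ChordPhase.chord_sum_le`), and a pointwise majorant `g_m` of their norms gives
  `Σ' k, φ(kᵢ)‖𝓕θ(k)‖² ≤ Σ_m φ(m)∫ g_m²`.
WHAT THIS IS NOT: no statement about the cascade; no `L²` kernel bound for the line quantities (that is the next file).
[cite: Grafakos2014, Prop. 3.1.2 (5) (coefficients of translates) and Prop. 3.2.7 (3) (Parseval)] [problem: turb]
-/

-- `Summit.<Summit>.<Problem>`: single-conjunct summit, the duplicate namespace segment is deliberate.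
set_option linter.dupNamespace false

noncomputable section

namespace Summit.AnomalousDissipation.AnomalousDissipation.Theorems.SawtoothPulseCascade.K1Start

open MeasureTheory Set Filter Topology UnitAddTorus Function
open Literature.Analysis.FunctionSpaces Literature.Analysis.FunctionSpaces.Torus

variable {d : Type*} [Fintype d] [DecidableEq d]

/-! ## §1 The twisted axis average and its Fourier coefficients -/

omit [DecidableEq d] in
/-- The twisted axis average of a continuous field is continuous (continuous integrand on the compact `T^d × T`).
[folklore] -/
theorem continuous_twistedAxisAvg [DecidableEq d] {v : UnitAddTorus d → ℂ} (hv : Continuous v) (i : d) (m : ℤ) :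
    Continuous fun x : UnitAddTorus d => ∫ s : UnitAddCircle, (fourier (-m) s : ℂ) • v (x + Pi.single i s) := by
  have hF : Continuous (uncurry fun (x : UnitAddTorus d) (s : UnitAddCircle) =>
      (fourier (-m) s : ℂ) • v (x + Pi.single i s)) := by
    refine Continuous.smul ((fourier (-m)).continuous.comp continuous_snd) (hv.comp ?_)
    exact continuous_fst.add ((continuous_single i).comp continuous_snd)
  have h := continuous_parametric_integral_of_continuous (μ := (volume : Measure UnitAddCircle)) hF isCompact_univ
  simpa only [Measure.restrict_univ] using h

/-- **Fubini for the coefficients of the twisted axis average**: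
`𝓕(x ↦ ∫ e_{−m}(s)v(x + s eᵢ)ds)(k) = ∫ e_{−m}(s)·𝓕(v(· + s eᵢ))(k) ds` for continuous `v`. [folklore] -/
theorem mFourierCoeff_twistedAxisAvg_eq_integral {v : UnitAddTorus d → ℂ} (hv : Continuous v) (i : d) (m : ℤ)
    (k : d → ℤ) :
    mFourierCoeff (fun x => ∫ s : UnitAddCircle, (fourier (-m) s : ℂ) • v (x + Pi.single i s)) k =
      ∫ s : UnitAddCircle, (fourier (-m) s : ℂ) • mFourierCoeff (fun x => v (x + Pi.single i s)) k := by
  simp_rw [mFourierCoeff_eq_integral_volume]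
  set f : UnitAddTorus d → UnitAddCircle → ℂ :=
    fun x s => (fourier (-m) s : ℂ) • (mFourier (-k) x • v (x + Pi.single i s)) with hf
  have hcont : Continuous (uncurry f) := by
    refine Continuous.smul ((fourier (-m)).continuous.comp continuous_snd) ?_
    refine Continuous.smul ((mFourier (-k)).continuous.comp continuous_fst) (hv.comp ?_)
    exact continuous_fst.add ((continuous_single i).comp continuous_snd)
  obtain ⟨C, hC⟩ := (isCompact_univ (X := UnitAddTorus d)).exists_bound_of_continuousOn hv.continuousOn
  have hbound : ∀ p : UnitAddTorus d × UnitAddCircle, ‖uncurry f p‖ ≤ C := by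
    rintro ⟨x, s⟩
    simp only [uncurry, hf, norm_smul]
    have h1 : ‖mFourier (-k) x‖ ≤ 1 := ((mFourier (-k)).norm_coe_le_norm x).trans_eq mFourier_norm
    have h2 : ‖(fourier (-m) s : ℂ)‖ ≤ 1 := ((fourier (-m)).norm_coe_le_norm s).trans_eq (fourier_norm (-m))
    have h3 : ‖v (x + Pi.single i s)‖ ≤ C := hC _ (mem_univ _)
    have hC0 : 0 ≤ C := (norm_nonneg _).trans h3
    calc ‖(fourier (-m) s : ℂ)‖ * (‖mFourier (-k) x‖ * ‖v (x + Pi.single i s)‖) ≤ 1 * (1 * C) := by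
          gcongr
      _ = C := by ring
  have hint : Integrable (uncurry f) ((volume : Measure (UnitAddTorus d)).prod (volume : Measure UnitAddCircle)) :=
    (integrable_const C).mono' hcont.aestronglyMeasurable (ae_of_all _ hbound)
  have h1 : (fun x => mFourier (-k) x • ∫ s : UnitAddCircle, (fourier (-m) s : ℂ) • v (x + Pi.single i s)) =
      fun x => ∫ s, f x s := by
    funext x
    rw [← integral_smul]
    refine integral_congr_ae (Eventually.of_forall fun s => ?_)
    simp only [hf]
    rw [smul_comm]
  rw [h1, integral_integral_swap hint]
  refine integral_congr_ae (Eventually.of_forall fun s => ?_)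
  simp only [hf]
  exact integral_smul _ _

/-- **The twisted axis average keeps exactly the slab `kᵢ = m`**: `𝓕(x ↦ ∫ e_{−m}(s)v(x + s eᵢ)ds)(k) = 𝓕v(k)` if `kᵢ = m`
and `= 0` otherwise (`v` continuous). [cite: Grafakos2014, Prop. 3.1.2 (5)] -/
theorem mFourierCoeff_twistedAxisAvg {v : UnitAddTorus d → ℂ} (hv : Continuous v) (i : d) (m : ℤ) (k : d → ℤ) :
    mFourierCoeff (fun x => ∫ s : UnitAddCircle, (fourier (-m) s : ℂ) • v (x + Pi.single i s)) k =
      if k i = m then mFourierCoeff v k else 0 := by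
  rw [mFourierCoeff_twistedAxisAvg_eq_integral hv i m k]
  simp_rw [mFourierCoeff_comp_add_single, smul_smul]
  rw [integral_smul_const]
  have hprod : (fun s : UnitAddCircle => (fourier (-m) s : ℂ) * (fourier (k i) s : ℂ)) =
      fun s => (fourier (k i - m) s : ℂ) := by
    funext s
    rw [show k i - m = -m + k i by ring, fourier_add]
  rw [hprod, integral_fourier_unitAddCircle]
  by_cases hk : k i = m
  · rw [if_pos (sub_eq_zero.mpr hk), if_pos hk, one_smul]
  · rw [if_neg (sub_ne_zero.mpr hk), if_neg hk, zero_smul]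

/-! ## §2 Parseval on a slab -/

/-- **Parseval on the slab `{kᵢ = m}`**: for continuous `v`,
`Σ_k [kᵢ = m]‖𝓕v(k)‖² = ∫ ‖∫ e_{−m}(s) v(x + s eᵢ) ds‖² dx`. [cite: Grafakos2014, Prop. 3.2.7 (3)] -/
theorem hasSum_slab {v : UnitAddTorus d → ℂ} (hv : Continuous v) (i : d) (m : ℤ) :
    HasSum (fun k : d → ℤ => (if k i = m then (1 : ℝ) else 0) * ‖mFourierCoeff v k‖ ^ 2)
      (∫ x : UnitAddTorus d, ‖∫ s : UnitAddCircle, (fourier (-m) s : ℂ) • v (x + Pi.single i s)‖ ^ 2) := by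
  have hP := hasSum_sq_mFourierCoeff_of_continuous (continuous_twistedAxisAvg hv i m)
  refine hP.congr_fun fun k => ?_
  rw [mFourierCoeff_twistedAxisAvg hv i m k]
  split_ifs with hk
  · rw [one_mul]
  · rw [norm_zero, zero_pow two_ne_zero, zero_mul]

/-! ## §3 Weighted strips (finitely supported transversal weights) -/

/-- **Strip energy with a finitely supported weight**: for continuous `v`, a finite set `S` of transversal frequencies and
weights `φ`, `Σ' k, (Σ_{m ∈ S} [kᵢ = m] φ(m))·‖𝓕v(k)‖² = Σ_{m ∈ S} φ(m)·∫ ‖∫ e_{−m}(s)v(x + s eᵢ)ds‖² dx`.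
[cite: Grafakos2014, Prop. 3.2.7 (3)] -/
theorem tsum_strip_eq {v : UnitAddTorus d → ℂ} (hv : Continuous v) (i : d) (S : Finset ℤ) (φ : ℤ → ℝ) :
    ∑' k : d → ℤ, (∑ m ∈ S, if k i = m then φ m else 0) * ‖mFourierCoeff v k‖ ^ 2 =
      ∑ m ∈ S, φ m * ∫ x : UnitAddTorus d, ‖∫ s : UnitAddCircle, (fourier (-m) s : ℂ) • v (x + Pi.single i s)‖ ^ 2 := by
  have hm : ∀ m ∈ S, HasSum (fun k : d → ℤ => (if k i = m then φ m else 0) * ‖mFourierCoeff v k‖ ^ 2)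
      (φ m * ∫ x : UnitAddTorus d, ‖∫ s : UnitAddCircle, (fourier (-m) s : ℂ) • v (x + Pi.single i s)‖ ^ 2) := by
    intro m _
    have h := (hasSum_slab hv i m).mul_left (φ m)
    refine h.congr_fun fun k => ?_
    split_ifs <;> ring
  have hsum : HasSum (fun k : d → ℤ => ∑ m ∈ S, (if k i = m then φ m else 0) * ‖mFourierCoeff v k‖ ^ 2)
      (∑ m ∈ S, φ m * ∫ x : UnitAddTorus d, ‖∫ s : UnitAddCircle, (fourier (-m) s : ℂ) • v (x + Pi.single i s)‖ ^ 2) :=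
    hasSum_sum hm
  rw [← hsum.tsum_eq]
  refine tsum_congr fun k => ?_
  rw [Finset.sum_mul]

/-- The same with the weight written as a function of `kᵢ` supported in `S`:
`Σ' k, [kᵢ ∈ S]φ(kᵢ)·‖𝓕v(k)‖² = Σ_{m ∈ S} φ(m)·∫ ‖∫ e_{−m}(s)v(x + s eᵢ)ds‖² dx`. [cite: Grafakos2014, Prop. 3.2.7 (3)] -/
theorem tsum_strip_eq' {v : UnitAddTorus d → ℂ} (hv : Continuous v) (i : d) (S : Finset ℤ) (φ : ℤ → ℝ) :
    ∑' k : d → ℤ, (if k i ∈ S then φ (k i) else 0) * ‖mFourierCoeff v k‖ ^ 2 =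
      ∑ m ∈ S, φ m * ∫ x : UnitAddTorus d, ‖∫ s : UnitAddCircle, (fourier (-m) s : ℂ) • v (x + Pi.single i s)‖ ^ 2 := by
  rw [← tsum_strip_eq hv i S φ]
  refine tsum_congr fun k => ?_
  congr 1
  by_cases hk : k i ∈ S
  · rw [if_pos hk, Finset.sum_ite_eq S (k i) φ, if_pos hk]
  · rw [if_neg hk]
    refine (Finset.sum_eq_zero fun m hm => ?_).symm
    rw [if_neg]
    rintro rfl
    exact hk hm

/-! ## §4 Real scalars; the line quantities as interval integrals -/

/-- **Strip energy of a continuous real scalar, line form**: for a finite set `S` of transversal frequencies,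
`Σ' k, [kᵢ ∈ S]φ(kᵢ)·‖𝓕θ(k)‖² = Σ_{m ∈ S} φ(m)·∫_x ‖∫₀¹ e_{−m}(σ)·θ(x + σeᵢ) dσ‖² dx` — the inner integral is the modulated
chord integral along the line through `x` in direction `eᵢ`. [cite: Grafakos2014, Prop. 3.2.7 (3)] -/
theorem tsum_strip_real_eq {θ : UnitAddTorus d → ℝ} (hθ : Continuous θ) (i : d) (S : Finset ℤ) (φ : ℤ → ℝ) :
    ∑' k : d → ℤ, (if k i ∈ S then φ (k i) else 0) * ‖mFourierCoeff (fun x => (θ x : ℂ)) k‖ ^ 2 =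
      ∑ m ∈ S, φ m * ∫ x : UnitAddTorus d,
        ‖∫ σ in (0 : ℝ)..1, (fourier (-m) (σ : UnitAddCircle) : ℂ) * (θ (x + Pi.single i (σ : UnitAddCircle)) : ℂ)‖ ^ 2 := by
  have hθc : Continuous (fun x => (θ x : ℂ)) := Complex.continuous_ofReal.comp hθ
  rw [tsum_strip_eq' hθc i S φ]
  refine Finset.sum_congr rfl fun m _ => ?_
  congr 1
  refine integral_congr_ae (Eventually.of_forall fun x => ?_)
  simp only [smul_eq_mul]
  rw [integral_unitAddCircle_eq_intervalIntegral]

/-- **Strip energy from pointwise majorants of the modulated chords**: if for every `m ∈ S` and every `x`,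
`‖∫₀¹ e_{−m}(σ)θ(x + σeᵢ)dσ‖ ≤ g_m(x)` with `g_m` continuous, and `φ ≥ 0` on `S`, then
`Σ' k, [kᵢ ∈ S]φ(kᵢ)·‖𝓕θ(k)‖² ≤ Σ_{m ∈ S} φ(m)·∫ g_m²`. [cite: Grafakos2014, Prop. 3.2.7 (3)] -/
theorem tsum_strip_real_le {θ : UnitAddTorus d → ℝ} (hθ : Continuous θ) (i : d) (S : Finset ℤ) {φ : ℤ → ℝ}
    (hφ : ∀ m ∈ S, 0 ≤ φ m) {g : ℤ → UnitAddTorus d → ℝ} (hg : ∀ m ∈ S, Continuous (g m))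
    (hle : ∀ m ∈ S, ∀ x, ‖∫ σ in (0 : ℝ)..1, (fourier (-m) (σ : UnitAddCircle) : ℂ) *
      (θ (x + Pi.single i (σ : UnitAddCircle)) : ℂ)‖ ≤ g m x) :
    ∑' k : d → ℤ, (if k i ∈ S then φ (k i) else 0) * ‖mFourierCoeff (fun x => (θ x : ℂ)) k‖ ^ 2 ≤
      ∑ m ∈ S, φ m * ∫ x, g m x ^ 2 := by
  rw [tsum_strip_real_eq hθ i S φ]
  refine Finset.sum_le_sum fun m hm => mul_le_mul_of_nonneg_left ?_ (hφ m hm)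
  refine integral_mono_of_nonneg (Eventually.of_forall fun x => sq_nonneg _) (((hg m hm).pow 2).integrable_unitAddTorus)
    (Eventually.of_forall fun x => ?_)
  exact pow_le_pow_left₀ (norm_nonneg _) (hle m hm x) 2

end Summit.AnomalousDissipation.AnomalousDissipation.Theorems.SawtoothPulseCascade.K1Start
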